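import Mathlib
import Summits.Ventures.LatticeQCDFlow.TrivializingMaps.AcceptanceCurveFullMeasure
import Summits.Ventures.LatticeQCDFlow.TrivializingMaps.AcceptanceCurveSharp
import Summits.Ventures.LatticeQCDFlow.TrivializingMaps.BoundedWitnessCovariance
import HarnessLib

/-!
# The sharp acceptance–footprint function, exactly: `g♯(acc) = 1 - ((2 acc - 1)₊)²` on `[0, 1]`

Honest framing: exact (Metropolis-corrected) sampling algorithms for lattice gauge theory; figures
of merit are autocorrelation/cost numbers at stated couplings and volumes; no continuum-physics
claim.

Venture `LatticeQCDFlow` (cell pub-lqcd), topic `TrivializingMaps`; FANOUT row 28 (theory-1),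
THEORY-1 §36 (row 96h).  NEW WORK of the cell = the one-statement WRAPPER of four files of record;
nothing is cited as a fact.  Setting of THEOREM Q (`AcceptanceFootprint.abs_cov_le_of_meanAccept`):
reference measure `μ`, target density `p`, model density `q` (both `≥ 0`, unit mass), equilibrium
Metropolis acceptance `ā = ∫∫ min (p x q y, p y q x) ≥ acc`, bounded measurable witnesses
`|A| ≤ a`, `|B| ≤ b` exactly uncorrelated under the model.

* `abs_cov_le_exact_of_meanAccept` — **the law**: `|Cov_π(A, B)| ≤ G(acc) · a b` with
  `G(acc) = 1` for `acc ≤ ½` (`BoundedWitnessCovariance`, row 96g — no acceptance needed) and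
  `G(acc) = 4 acc (1 - acc)` for `acc > ½` (`AcceptanceCurveFullMeasure`, row 96e);
* `exact_function_eq` — `G(acc) = 1 - (max (2 acc - 1) 0)²`, the closed form;
* `Sharp.exact_law_isLeast` — **sharpness**: already on two links with two states each
  (counting reference measure) `G` IS a valid acceptance-only law, and every valid acceptance-only
  law `g` has `G(acc) ≤ g(acc)` for all `acc ∈ [0, 1]` (`AcceptanceFootprintFloor.one_le_of_law`,
  `AcceptanceCurveSharp.curve_le_of_law`, row 96f).  So `G = g♯`, the pointwise-least law.

NOT CLAIMED: anything about smooth / perturbative trivializing maps reaching any acceptance; cost,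
autocorrelation, continuum; witnesses with `a = 0` or `b = 0` in the general-measure law (the
two-link statement covers them).  No `sorry`, no new axioms, no `def`.
-/

namespace Summit.Ventures.LatticeQCDFlow.TrivializingMaps

open MeasureTheory Set
open scoped ENNReal NNReal

section Exact

variable {X : Type*} [MeasurableSpace X] {μ : Measure X} {p q : X → ℝ} [SFinite μ]

/-- **THE SHARP ACCEPTANCE–FOOTPRINT LAW ON ALL OF `[0, 1]`.**  Hypotheses of THEOREM Q with
`a, b > 0` and any real `acc ≤ ā`: `|Cov_π(A, B)| ≤ G(acc) · a b`, `G(acc) = 1` if `acc ≤ ½`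
(row 96g: true for bounded witnesses under any probability measure) and `G(acc) = 4 acc (1 - acc)`
if `acc > ½` (row 96e: the block inequality).  `G` is the least such function
(`Sharp.exact_law_isLeast`). -/
theorem abs_cov_le_exact_of_meanAccept (hp0 : ∀ x, 0 ≤ p x) (hpm : Measurable p)
    (hpi : Integrable p μ) (hp1 : ∫ x, p x ∂μ = 1) (hq0 : ∀ x, 0 ≤ q x) (hqm : Measurable q)
    (hqi : Integrable q μ) (hq1 : ∫ x, q x ∂μ = 1) {acc : ℝ}
    (hacc : acc ≤ ∫ x, ∫ y, min (p x * q y) (p y * q x) ∂μ ∂μ) {A B : X → ℝ}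
    (hAm : Measurable A) (hBm : Measurable B) {a b : ℝ} (ha : 0 < a) (hb : 0 < b)
    (hA : ∀ x, |A x| ≤ a) (hB : ∀ x, |B x| ≤ b)
    (hfac : ∫ x, A x * B x ∂(μ.withDensity fun x => ENNReal.ofReal (q x))
      = (∫ x, A x ∂(μ.withDensity fun x => ENNReal.ofReal (q x)))
        * ∫ x, B x ∂(μ.withDensity fun x => ENNReal.ofReal (q x))) :
    |∫ x, A x * B x ∂(μ.withDensity fun x => ENNReal.ofReal (p x))
        - (∫ x, A x ∂(μ.withDensity fun x => ENNReal.ofReal (p x)))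
          * ∫ x, B x ∂(μ.withDensity fun x => ENNReal.ofReal (p x))|
      ≤ (if acc ≤ 1 / 2 then (1 : ℝ) else 4 * acc * (1 - acc)) * (a * b) := by
  split_ifs with h
  · rw [one_mul]
    exact abs_cov_density_le_mul_of_abs_le μ hp0 hpi hp1 hAm hBm hA hB
  · exact Curve.abs_cov_le_curve_of_meanAccept hp0 hpm hpi hp1 hq0 hqm hqi hq1 hacc
      (le_of_lt (lt_of_not_ge h)) hAm hBm ha hb hA hB hfac

end Exact

/-- The closed form of the sharp footprint function: `G(acc) = 1 - ((2 acc - 1)₊)²`. -/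
theorem exact_function_eq (acc : ℝ) :
    (if acc ≤ 1 / 2 then (1 : ℝ) else 4 * acc * (1 - acc)) = 1 - (max (2 * acc - 1) 0) ^ 2 := by
  split_ifs with h
  · rw [max_eq_right (by linarith)]; ring
  · rw [max_eq_left (by linarith [lt_of_not_ge h])]; ring

namespace Sharp

/-- **SHARPNESS: `G` IS THE LEAST ACCEPTANCE-ONLY LAW (two links with two states each).**
(i) On `Bool × Bool` with the counting reference measure, `|Cov_π(A, B)| ≤ G(acc) · a b` holds for
all targets, models, acceptances `acc ≤ ā` and bounded witnesses exactly uncorrelated under the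
model (the law above, plus the degenerate witnesses `a = 0` or `b = 0`); (ii) every function `g`
with the same property satisfies `G(acc) ≤ g(acc)` for all `acc ∈ [0, 1]` (the floor family at
`acc ≤ ½`, the corner family at `acc ≥ ½`). -/
theorem exact_law_isLeast :
    (∀ (p q A B : Bool × Bool → ℝ) (a b acc : ℝ), (∀ z, 0 ≤ p z) → Measurable p →
      Integrable p (Measure.count : Measure (Bool × Bool)) →
      ∫ z, p z ∂(Measure.count : Measure (Bool × Bool)) = 1 → (∀ z, 0 ≤ q z) → Measurable q →
      Integrable q (Measure.count : Measure (Bool × Bool)) →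
      ∫ z, q z ∂(Measure.count : Measure (Bool × Bool)) = 1 →
      acc ≤ ∫ x, ∫ y, min (p x * q y) (p y * q x) ∂(Measure.count : Measure (Bool × Bool))
        ∂(Measure.count : Measure (Bool × Bool)) →
      Measurable A → Measurable B → (∀ z, |A z| ≤ a) → (∀ z, |B z| ≤ b) →
      ∫ z, A z * B z ∂((Measure.count : Measure (Bool × Bool)).withDensity fun z => ENNReal.ofReal (q z))
        = (∫ z, A z ∂((Measure.count : Measure (Bool × Bool)).withDensity fun z => ENNReal.ofReal (q z)))
          * ∫ z, B z ∂((Measure.count : Measure (Bool × Bool)).withDensity fun z => ENNReal.ofReal (q z)) →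
      |∫ z, A z * B z ∂((Measure.count : Measure (Bool × Bool)).withDensity fun z => ENNReal.ofReal (p z))
        - (∫ z, A z ∂((Measure.count : Measure (Bool × Bool)).withDensity fun z => ENNReal.ofReal (p z)))
          * ∫ z, B z ∂((Measure.count : Measure (Bool × Bool)).withDensity fun z => ENNReal.ofReal (p z))|
        ≤ (if acc ≤ 1 / 2 then (1 : ℝ) else 4 * acc * (1 - acc)) * (a * b))
    ∧ ∀ g : ℝ → ℝ, (∀ (p q A B : Bool × Bool → ℝ) (a b acc : ℝ), (∀ z, 0 ≤ p z) → Measurable p →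
      Integrable p (Measure.count : Measure (Bool × Bool)) →
      ∫ z, p z ∂(Measure.count : Measure (Bool × Bool)) = 1 → (∀ z, 0 ≤ q z) → Measurable q →
      Integrable q (Measure.count : Measure (Bool × Bool)) →
      ∫ z, q z ∂(Measure.count : Measure (Bool × Bool)) = 1 →
      acc ≤ ∫ x, ∫ y, min (p x * q y) (p y * q x) ∂(Measure.count : Measure (Bool × Bool))
        ∂(Measure.count : Measure (Bool × Bool)) →
      Measurable A → Measurable B → (∀ z, |A z| ≤ a) → (∀ z, |B z| ≤ b) →
      ∫ z, A z * B z ∂((Measure.count : Measure (Bool × Bool)).withDensity fun z => ENNReal.ofReal (q z))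
        = (∫ z, A z ∂((Measure.count : Measure (Bool × Bool)).withDensity fun z => ENNReal.ofReal (q z)))
          * ∫ z, B z ∂((Measure.count : Measure (Bool × Bool)).withDensity fun z => ENNReal.ofReal (q z)) →
      |∫ z, A z * B z ∂((Measure.count : Measure (Bool × Bool)).withDensity fun z => ENNReal.ofReal (p z))
        - (∫ z, A z ∂((Measure.count : Measure (Bool × Bool)).withDensity fun z => ENNReal.ofReal (p z)))
          * ∫ z, B z ∂((Measure.count : Measure (Bool × Bool)).withDensity fun z => ENNReal.ofReal (p z))|
        ≤ g acc * (a * b)) →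
      ∀ acc : ℝ, 0 ≤ acc → acc ≤ 1 →
        (if acc ≤ 1 / 2 then (1 : ℝ) else 4 * acc * (1 - acc)) ≤ g acc := by
  refine ⟨?_, fun g hlaw acc h0 h1 => envelope_le_of_law g hlaw h0 h1⟩
  intro p q A B a b acc hp0 hpm hpi hp1 hq0 hqm hqi hq1 hacc hAm hBm hA hB hfac
  rcases (abs_nonneg (A (true, true))).trans (hA (true, true)) |>.eq_or_lt with ha0 | ha
  · -- `a = 0`: the witness `A` vanishes identically, so the covariance is `0`
    have hA0 : A = fun _ => 0 := funext fun z => abs_nonpos_iff.1 (ha0 ▸ hA z)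
    subst hA0 ha0
    simp
  rcases (abs_nonneg (B (true, true))).trans (hB (true, true)) |>.eq_or_lt with hb0 | hb
  · -- `b = 0`: symmetric
    have hB0 : B = fun _ => 0 := funext fun z => abs_nonpos_iff.1 (hb0 ▸ hB z)
    subst hB0 hb0
    simp
  exact abs_cov_le_exact_of_meanAccept hp0 hpm hpi hp1 hq0 hqm hqi hq1 hacc hAm hBm ha hb hA hB
    hfac

end Sharp

end Summit.Ventures.LatticeQCDFlow.TrivializingMaps
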